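import Literature.NumberTheory.EllipticCurves.SilvermanHeightLogDiscriminant
import Mathlib.NumberTheory.ModularForms.LevelOne.GradedRing
import Mathlib.NumberTheory.Modular
import Mathlib.MeasureTheory.Measure.Lebesgue.Complex
import Mathlib.NumberTheory.LSeries.HurwitzZetaValues
import HarnessLib

/-!
# Silverman 1986, Cor. 2.3: `log max(|Δ_min|, |c₄|³) − 12 h(E/ℚ)` is `≥ O(1)` and `≤ 6 log log + O(1)` — proofs

Topic `Literature/NumberTheory/EllipticCurves`; sibling PROOFS file of
`SilvermanHeightLogDiscriminant.lean`, discharging its named fact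
`silverman1986_log_max_sub_height` (D-0014):

* `silverman1986_log_max_sub_height_holds : silverman1986_log_max_sub_height` — there are
  absolute constants `C₀, C₁` with
  `C₀ ≤ log M − 12 h ≤ 6 log(1 + log M) + C₁`, `M = max(|Δ_W|, |c₄(W)|³)`,
  `h = neronLatticeHeight L = −½ log covol(Λ)`, for every global minimal `W/ℚ` and every period
  pair `L` spanning its Néron lattice.

No new definitions, no new named facts; all helpers are `private`.

**Source (held as `book:cornellnd-arithmetic-geometry`, pp. 330–334, read).** J. H. Silverman,
*Heights and elliptic curves*, in: Arithmetic Geometry (Cornell–Silverman eds.), Springer 1986,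
Ch. X: Prop. 1.1 (`12 h(E/ℚ) = log|Δ_{E/ℚ}| − log(|Δ(τ)| (Im τ)⁶)`, the area of a fundamental
parallelogram), §2 estimates (4) `log|Δ(τ)| = log|q_τ| + O(1)`, (5)
`log max{|j(τ)|, 1} = log|1/q_τ| + O(1)` (split at a horizontal line), (7)
`log Im τ = log log max{|j|, e} + O(1)`, and the proof of Cor. 2.3 (p. 334):
`O(1) ≤ log max{|jΔ|, |Δ|} − 12 h(E/ℚ) ≤ 6 log(1 + h(j)) + O(1)`, `h(j) ≤ log max{|jΔ|, |Δ|}`.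

## The argument formalised (Silverman's, on `Im τ ≥ 1/2` instead of the fundamental domain)

1. **Reduction** (`exists_normalForm`): every period lattice `Λ = ℤω₁ + ℤω₂` has
   `G₄(Λ) = ω⁻⁴ · 2ζ(4) E₄(τ)`, `G₆(Λ) = ω⁻⁶ · 2ζ(6) E₆(τ)` and `covol(Λ) = |ω|² Im τ` for some
   `ω ≠ 0` and `τ ∈ ℍ` with `Im τ ≥ 1/2`: write the lattice sums over `ℤ²`
   (Mathlib `tsum_eisSummand_eq_riemannZeta_mul_eisensteinSeries`), take `τ₀ = ω₂/ω₁` (after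
   interchanging the periods if `Im(ω₂/ω₁) < 0`), move `τ₀` by `γ ∈ SL₂(ℤ)`
   (`ModularGroup.exists_one_half_le_im_smul`, modularity of `E₄, E₆`), and compute the covolume
   as `|det(ω₁, ω₂)|` for Lebesgue measure on `ℂ`.
2. **Dictionary** (Silverman AEC VI.3.6 / (14)): for a Néron lattice (`g₂ = c₄/12`, `g₃ = c₆/216`),
   `c₄ = 16π⁴ ω⁻⁴ E₄(τ)`, `c₆ = 64π⁶ ω⁻⁶ E₆(τ)` (`ζ(4) = π⁴/90`, `ζ(6) = π⁶/945`), hence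
   `Δ_W = (c₄³ − c₆²)/1728 = 2¹²π¹² ω⁻¹² Δ(τ)` (Mathlib `discriminant_eq_E₄_cube_sub_E₆_sq`), so
   `M · covol⁶ = 2¹²π¹² (Im τ)⁶ max(|Δ(τ)|, |E₄(τ)|³)` and, as `|Δ_W| ≥ 1`,
   `M ≥ |E₄(τ)|³/|Δ(τ)| = |j(τ)|`.
3. **`q`-disc estimates on `Im τ ≥ 1/2`** (`|q| ≤ e^{−π}`; Silverman's (4), (5)), all from the
   continuity of the `q`-expansions (`cuspFunction`) on the closed disc `|q| ≤ e^{−π}`: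
   `E₄` and `Δ` are bounded; `|E₄(τ)| ≥ 1/2` for `Im τ ≥ Y` (value `1` at the cusp);
   `|Δ(τ)| ≤ K e^{−2π Im τ}` (cusp form: Mathlib `CuspFormClass.exp_decay_atImInfty` high up,
   boundedness below); `|Δ(τ)| ≥ m > 0` on `1/2 ≤ Im τ ≤ Y` (compact annulus, `Δ = η²⁴ ≠ 0`).
4. **Assembly** (Silverman's (6), (7)): the lower bound from `max(|Δ|, |E₄|³)(Im τ)⁶ ≥ min(m, 1/8)/64`;
   the upper bound from `Im τ ≤ Y` or `|j(τ)| ≥ e^{2π Im τ}/(8K)`, i.e.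
   `Im τ ≤ A (1 + log M)`, giving `log(M covol⁶) ≤ C₁ + 6 log(1 + log M)`.

Not here: the number-field version (Prop. 2.1), explicit values of the constants, the Weil
height `h(j)` itself (only its printed majorant `log max{|jΔ|, |Δ|}` enters the fact).

## References

* J. H. Silverman, *Heights and elliptic curves*, in Arithmetic Geometry (Cornell–Silverman eds.),
  Springer (1986) 253–265: Prop. 1.1, §2 (4)–(7), Cor. 2.3 with proof (p. 334), (14).
  [`Silverman1986`]
* J. H. Silverman, *The Arithmetic of Elliptic Curves*, 2nd ed. (2009), VI.3.6, C.12.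
  [`SilvermanAEC2009`]
-/

noncomputable section

namespace Literature.NumberTheory.EllipticCurves.ModularForms

open _root_.Complex _root_.UpperHalfPlane _root_.EisensteinSeries _root_.ModularForm
open scoped MatrixGroups Real

/-! ### Step 1: reduction of a period lattice to `ω(ℤτ + ℤ)`, `Im τ ≥ 1/2` -/

/-- `covol(ℤω₁ + ℤω₂) = |Re ω₁ Im ω₂ − Im ω₁ Re ω₂|` for Lebesgue measure on `ℂ` (the area of a
fundamental parallelogram; Silverman 1986, proof of Prop. 1.1). [folklore] -/
private theorem covolume_lattice_eq (L : PeriodPair) :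
    ZLattice.covolume L.lattice = |L.ω₁.re * L.ω₂.im - L.ω₁.im * L.ω₂.re| := by
  classical
  rw [ZLattice.covolume_eq_det_mul_measureReal L.lattice MeasureTheory.volume L.latticeBasis
    Complex.basisOneI]
  have h1 : MeasureTheory.volume.real (ZSpan.fundamentalDomain Complex.basisOneI) = 1 := by
    rw [MeasureTheory.measureReal_congr
      (ZSpan.fundamentalDomain_ae_parallelepiped Complex.basisOneI MeasureTheory.volume),
      MeasureTheory.measureReal_def, ← Complex.toBasis_orthonormalBasisOneI,
      OrthonormalBasis.coe_toBasis, Complex.orthonormalBasisOneI.volume_parallelepiped]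
    simp
  rw [h1, mul_one, Module.Basis.det_apply, Matrix.det_fin_two]
  simp only [Module.Basis.toMatrix_apply, Complex.coe_basisOneI_repr, Function.comp_apply,
    PeriodPair.latticeBasis_zero, PeriodPair.latticeBasis_one, Matrix.cons_val_zero,
    Matrix.cons_val_one]
  congr 1; ring

/-- The lattice sums `G_k(Λ) = ∑_{λ ∈ Λ} λ^{-k}` written over `ℤ²`. [folklore] -/
private theorem G_eq_tsum_prod (L : PeriodPair) (k : ℕ) :
    L.G k = ∑' x : ℤ × ℤ, ((x.1 * L.ω₁ + x.2 * L.ω₂) ^ k)⁻¹ := by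
  rw [PeriodPair.G, ← (Equiv.tsum_eq L.latticeEquivProd.symm.toEquiv
    (fun l : L.lattice => ((l : ℂ) ^ k)⁻¹))]
  congr with x
  simp [L.latticeEquiv_symm_apply]

/-- Reindexing `ℤ × ℤ ≃ (Fin 2 → ℤ)` in the Eisenstein summands. [folklore] -/
private theorem tsum_prod_eisSummand (k : ℤ) (τ : ℍ) :
    ∑' x : ℤ × ℤ, eisSummand k ![x.2, x.1] τ = ∑' v : Fin 2 → ℤ, eisSummand k v τ := by
  rw [← Equiv.tsum_eq ((Equiv.prodComm ℤ ℤ).trans (finTwoArrowEquiv ℤ).symm)]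
  rfl

/-- `∑_{(m,n) ∈ ℤ²} (mτ + n)^{-k} = 2ζ(k) E_k(τ)` (Mathlib: the sum over all pairs is `ζ(k)` times
the sum over coprime pairs, which is `2 E_k`). [folklore] -/
private theorem two_mul_zeta_mul_E_apply {k : ℕ} (hk : 3 ≤ k) (τ : ℍ) :
    2 * riemannZeta k * E hk τ = ∑' v : Fin 2 → ℤ, eisSummand k v τ := by
  rw [tsum_eisSummand_eq_riemannZeta_mul_eisensteinSeries hk,
    show E hk τ = (1 / 2 : ℂ) • eisensteinSeriesSIF (N := 1) 0 k τ from rfl,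
    eisensteinSeriesSIF_apply, smul_eq_mul]
  ring

/-- `G_k(ℤω₁ + ℤω₂) = ω₁^{-k} · 2ζ(k) E_k(ω₂/ω₁)` when `Im(ω₂/ω₁) > 0` (homogeneity of the
lattice sums; Silverman AEC C.12, Serre VII §2.2). [folklore] -/
private theorem G_eq_of_im_pos (L : PeriodPair) (h : 0 < (L.ω₂ / L.ω₁).im) {k : ℕ}
    (hk : 3 ≤ k) :
    L.G k = (L.ω₁ ^ k)⁻¹ * (2 * riemannZeta k * E hk (UpperHalfPlane.mk _ h)) := by
  have hω₁ : L.ω₁ ≠ 0 := by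
    rintro h0
    simp [h0] at h
  rw [two_mul_zeta_mul_E_apply, ← tsum_prod_eisSummand, G_eq_tsum_prod, ← tsum_mul_left]
  congr with x
  rw [eisSummand, zpow_neg, zpow_natCast, ← mul_inv, ← mul_pow]
  congr 2
  simp only [Matrix.cons_val_zero, Matrix.cons_val_one]
  field_simp
  ring

/-- `Im(b/a) · |a|² = Re a Im b − Im a Re b`. [folklore] -/
private theorem im_div_mul_normSq (a b : ℂ) (ha : a ≠ 0) :
    (b / a).im * Complex.normSq a = a.re * b.im - a.im * b.re := by
  rw [Complex.div_im]
  field_simp [(Complex.normSq_pos.mpr ha).ne']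

/-- Reduction when `Im(ω₂/ω₁) > 0`: with `τ₀ = ω₂/ω₁` and `γ ∈ SL₂(ℤ)` such that
`Im(γτ₀) ≥ 1/2` (`ModularGroup.exists_one_half_le_im_smul`), put `τ = γτ₀`,
`ω = ω₁ · (cτ₀ + d)`; then `G_k(Λ) = ω^{-k} 2ζ(k)E_k(τ)` (`E_k(γτ₀) = (cτ₀+d)^k E_k(τ₀)`) and
`covol(Λ) = |ω₁|² Im τ₀ = |ω|² Im τ`. (Silverman 1986, §2: "we choose our `τ_v`'s in the usual
fundamental domain".) [folklore] -/
private theorem exists_normalForm_of_im_pos (L : PeriodPair) (h : 0 < (L.ω₂ / L.ω₁).im) :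
    ∃ (ω : ℂ) (τ : ℍ), ω ≠ 0 ∧ 1 / 2 ≤ τ.im ∧
      L.G 4 = (ω ^ 4)⁻¹ * (2 * riemannZeta (4 : ℕ) * E₄ τ) ∧
      L.G 6 = (ω ^ 6)⁻¹ * (2 * riemannZeta (6 : ℕ) * E₆ τ) ∧
      ZLattice.covolume L.lattice = ‖ω‖ ^ 2 * τ.im := by
  have hω₁ : L.ω₁ ≠ 0 := by
    rintro h0
    simp [h0] at h
  set τ₀ : ℍ := UpperHalfPlane.mk _ h with hτ₀
  obtain ⟨γ, hγ⟩ := ModularGroup.exists_one_half_le_im_smul τ₀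
  have hmem : (γ : GL (Fin 2) ℝ) ∈ 𝒮ℒ := ⟨γ, rfl⟩
  have hd : denom γ τ₀ ≠ 0 := denom_ne_zero γ τ₀
  refine ⟨L.ω₁ * denom γ τ₀, γ • τ₀, mul_ne_zero hω₁ hd, hγ, ?_, ?_, ?_⟩
  · have h4 := SlashInvariantForm.slash_action_eqn'' E₄ hmem τ₀
    rw [ModularGroup.sl_moeb, h4, G_eq_of_im_pos L h (k := 4) (by norm_num)]
    rw [mul_pow, mul_inv, zpow_ofNat]
    field_simp
    rfl
  · have h6 := SlashInvariantForm.slash_action_eqn'' E₆ hmem τ₀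
    rw [ModularGroup.sl_moeb, h6, G_eq_of_im_pos L h (k := 6) (by norm_num)]
    rw [mul_pow, mul_inv, zpow_ofNat]
    field_simp
    rfl
  · rw [ModularGroup.im_smul_eq_div_normSq, covolume_lattice_eq, norm_mul, mul_pow,
      Complex.sq_norm, Complex.sq_norm]
    field_simp
    rw [show τ₀.im = (L.ω₂ / L.ω₁).im from rfl]
    rw [abs_of_pos]
    · have := im_div_mul_normSq L.ω₁ L.ω₂ hω₁
      linarith
    · have := im_div_mul_normSq L.ω₁ L.ω₂ hω₁
      have hn : 0 < Complex.normSq L.ω₁ := Complex.normSq_pos.mpr hω₁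
      nlinarith

/-- **Reduction of an arbitrary period lattice**: `G₄(Λ) = ω⁻⁴ · 2ζ(4) E₄(τ)`,
`G₆(Λ) = ω⁻⁶ · 2ζ(6) E₆(τ)` and `covol(Λ) = |ω|² Im τ` for some `ω ≠ 0` and `τ ∈ ℍ` with
`Im τ ≥ 1/2` (interchange the periods if `Im(ω₂/ω₁) < 0`; `Im(ω₂/ω₁) ≠ 0` because
`covol(Λ) = |ω₁|²|Im(ω₂/ω₁)| > 0`). (Silverman AEC C.12; Serre VII §2.2.) [folklore] -/
private theorem exists_normalForm (L : PeriodPair) :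
    ∃ (ω : ℂ) (τ : ℍ), ω ≠ 0 ∧ 1 / 2 ≤ τ.im ∧
      L.G 4 = (ω ^ 4)⁻¹ * (2 * riemannZeta (4 : ℕ) * E₄ τ) ∧
      L.G 6 = (ω ^ 6)⁻¹ * (2 * riemannZeta (6 : ℕ) * E₆ τ) ∧
      ZLattice.covolume L.lattice = ‖ω‖ ^ 2 * τ.im := by
  have hpos := ZLattice.covolume_pos L.lattice MeasureTheory.volume
  rw [covolume_lattice_eq] at hpos
  have hD : L.ω₁.re * L.ω₂.im - L.ω₁.im * L.ω₂.re ≠ 0 := abs_pos.mp hpos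
  rcases lt_or_gt_of_ne hD with hneg | hpos'
  · -- interchange the periods
    have hω₂ : L.ω₂ ≠ 0 := by
      rintro h0
      simp [h0] at hneg
    let L' : PeriodPair :=
      { ω₁ := L.ω₂
        ω₂ := L.ω₁
        indep := by
          rw [LinearIndependent.pair_iff]
          intro s t hst
          have := (LinearIndependent.pair_iff.mp L.indep) t s (by rw [add_comm]; exact hst)
          exact ⟨this.2, this.1⟩ }
    have hlat : L'.lattice = L.lattice := by
      rw [PeriodPair.lattice, PeriodPair.lattice, Set.pair_comm]
    have hG : ∀ n, L'.G n = L.G n := fun n => by rw [PeriodPair.G, PeriodPair.G, hlat]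
    have hc : ZLattice.covolume L'.lattice = ZLattice.covolume L.lattice := by
      rw [covolume_lattice_eq, covolume_lattice_eq, abs_sub_comm]
      congr 1; ring
    have h : 0 < (L'.ω₂ / L'.ω₁).im := by
      have := im_div_mul_normSq L.ω₂ L.ω₁ hω₂
      have hn : 0 < Complex.normSq L.ω₂ := Complex.normSq_pos.mpr hω₂
      have h' : L.ω₂.re * L.ω₁.im - L.ω₂.im * L.ω₁.re =
          -(L.ω₁.re * L.ω₂.im - L.ω₁.im * L.ω₂.re) := by ring
      exact (mul_pos_iff_of_pos_right hn).mp (by rw [this, h']; linarith)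
    obtain ⟨ω, τ, h1, h2, h3, h4, h5⟩ := exists_normalForm_of_im_pos L' h
    exact ⟨ω, τ, h1, h2, (hG 4) ▸ h3, (hG 6) ▸ h4, hc ▸ h5⟩
  · have hω₁ : L.ω₁ ≠ 0 := by
      rintro h0
      simp [h0] at hpos'
    have h : 0 < (L.ω₂ / L.ω₁).im := by
      have := im_div_mul_normSq L.ω₁ L.ω₂ hω₁
      have hn : 0 < Complex.normSq L.ω₁ := Complex.normSq_pos.mpr hω₁
      exact (mul_pos_iff_of_pos_right hn).mp (by rw [this]; exact hpos')
    exact exists_normalForm_of_im_pos L h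

/-! ### Step 2: the dictionary `c₄ = 16π⁴ω⁻⁴E₄(τ)`, `Δ_W = 2¹²π¹²ω⁻¹²Δ(τ)` -/

/-- `B₅' = 0`. [folklore] -/
private theorem bernoulli'_five : bernoulli' 5 = 0 := by
  have h1 : Nat.choose 5 2 = 10 := by decide
  have h2 : Nat.choose 5 3 = 10 := by decide
  have h3 : Nat.choose 5 4 = 5 := by decide
  rw [bernoulli'_def]
  norm_num [Finset.sum_range_succ, h1, h2, h3]

/-- `B₆' = 1/42`. [folklore] -/
private theorem bernoulli'_six : bernoulli' 6 = 1 / 42 := by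
  have h1 : Nat.choose 6 2 = 15 := by decide
  have h2 : Nat.choose 6 3 = 20 := by decide
  have h3 : Nat.choose 6 4 = 15 := by decide
  have h4 : Nat.choose 6 5 = 6 := by decide
  rw [bernoulli'_def]
  norm_num [Finset.sum_range_succ, h1, h2, h3, h4, bernoulli'_five]

/-- `ζ(6) = π⁶/945` (Euler; from Mathlib's `ζ(2k)` Bernoulli formula and `B₆ = 1/42`).
[folklore] -/
private theorem riemannZeta_six : riemannZeta 6 = π ^ 6 / 945 := by
  have hb : bernoulli 6 = 1 / 42 := by
    rw [bernoulli_eq_bernoulli'_of_ne_one (by norm_num), bernoulli'_six]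
  have h := riemannZeta_two_mul_nat (k := 3) (by norm_num)
  rw [show (2 * ((3 : ℕ) : ℂ)) = 6 by norm_num, show 2 * 3 = 6 from rfl, hb] at h
  rw [h]
  norm_num [Nat.factorial]
  ring

/-- `c₄ = 12 g₂ = 16π⁴ ω⁻⁴ E₄(τ)` for a Néron lattice in normal form (`g₂ = 60 G₄`,
`ζ(4) = π⁴/90`; Silverman AEC VI.3.6, C.12). [folklore] -/
private theorem c₄_eq_of_normalForm (W : WeierstrassCurve ℚ) (L : PeriodPair)
    (hL : IsNeronLatticeOf (W.baseChange ℂ) L) {ω : ℂ} {τ : ℍ}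
    (hG4 : L.G 4 = (ω ^ 4)⁻¹ * (2 * riemannZeta (4 : ℕ) * E₄ τ)) :
    ((W.c₄ : ℚ) : ℂ) = 16 * π ^ 4 * (ω ^ 4)⁻¹ * E₄ τ := by
  have h1 := hL.1
  rw [WeierstrassCurve.baseChange, WeierstrassCurve.map_c₄, eq_ratCast, PeriodPair.g₂, hG4,
    Nat.cast_ofNat, riemannZeta_four] at h1
  have : ((W.c₄ : ℚ) : ℂ) = 12 * (60 * ((ω ^ 4)⁻¹ * (2 * (π ^ 4 / 90) * E₄ τ))) := by
    rw [h1]; ring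
  rw [this]; ring

/-- `c₆ = 216 g₃ = 64π⁶ ω⁻⁶ E₆(τ)` for a Néron lattice in normal form (`g₃ = 140 G₆`,
`ζ(6) = π⁶/945`; Silverman AEC VI.3.6, C.12). [folklore] -/
private theorem c₆_eq_of_normalForm (W : WeierstrassCurve ℚ) (L : PeriodPair)
    (hL : IsNeronLatticeOf (W.baseChange ℂ) L) {ω : ℂ} {τ : ℍ}
    (hG6 : L.G 6 = (ω ^ 6)⁻¹ * (2 * riemannZeta (6 : ℕ) * E₆ τ)) :
    ((W.c₆ : ℚ) : ℂ) = 64 * π ^ 6 * (ω ^ 6)⁻¹ * E₆ τ := by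
  have h1 := hL.2
  rw [WeierstrassCurve.baseChange, WeierstrassCurve.map_c₆, eq_ratCast, PeriodPair.g₃, hG6,
    Nat.cast_ofNat, riemannZeta_six] at h1
  have : ((W.c₆ : ℚ) : ℂ) = 216 * (140 * ((ω ^ 6)⁻¹ * (2 * (π ^ 6 / 945) * E₆ τ))) := by
    rw [h1]; ring
  rw [this]; ring

/-- `Δ_W = (c₄³ − c₆²)/1728 = 2¹²π¹² ω⁻¹² Δ(τ)` (Mathlib `WeierstrassCurve.c_relation` and
`ModularForm.discriminant_eq_E₄_cube_sub_E₆_sq`; Silverman 1986, §1 "`Δ_v = g₂³ − 27g₃² = Δ(τ_v)`").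
[folklore] -/
private theorem Δ_eq_of_normalForm (W : WeierstrassCurve ℚ) (L : PeriodPair)
    (hL : IsNeronLatticeOf (W.baseChange ℂ) L) {ω : ℂ} {τ : ℍ}
    (hG4 : L.G 4 = (ω ^ 4)⁻¹ * (2 * riemannZeta (4 : ℕ) * E₄ τ))
    (hG6 : L.G 6 = (ω ^ 6)⁻¹ * (2 * riemannZeta (6 : ℕ) * E₆ τ)) :
    ((W.Δ : ℚ) : ℂ) = 4096 * π ^ 12 * (ω ^ 12)⁻¹ * ModularForm.discriminant τ := by
  have h := congrArg (fun q : ℚ => (q : ℂ)) W.c_relation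
  simp only [Rat.cast_mul, Rat.cast_sub, Rat.cast_pow, Rat.cast_ofNat] at h
  rw [c₄_eq_of_normalForm W L hL hG4, c₆_eq_of_normalForm W L hL hG6] at h
  rw [ModularForm.discriminant_eq_E₄_cube_sub_E₆_sq]
  have : ((W.Δ : ℚ) : ℂ) = ((16 * π ^ 4 * (ω ^ 4)⁻¹ * E₄ τ) ^ 3 -
      (64 * π ^ 6 * (ω ^ 6)⁻¹ * E₆ τ) ^ 2) / 1728 := by
    rw [← h]; ring
  rw [this]
  ring

/-- `|q|_ℝ = ‖q‖_ℂ` for a rational number `q`. [folklore] -/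
private theorem abs_ratCast_eq_norm (q : ℚ) : |((q : ℚ) : ℝ)| = ‖((q : ℚ) : ℂ)‖ := by
  rw [← Complex.ofReal_ratCast, Complex.norm_real, Real.norm_eq_abs]

/-! ### Step 3: `q`-disc estimates for level one on `Im τ ≥ 1/2` (Silverman's (4), (5)) -/

/-- A level-one modular form is bounded on `Im τ ≥ 1/2`: its `q`-expansion is continuous on
the closed disc `|q| ≤ e^{−π}`. [folklore] -/
private theorem exists_norm_le_of_one_half_le_im {k : ℤ} {F : Type*} [FunLike F ℍ ℂ]
    [ModularFormClass F 𝒮ℒ k] (f : F) :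
    ∃ K : ℝ, ∀ τ : ℍ, 1 / 2 ≤ τ.im → ‖f τ‖ ≤ K := by
  have hcont : ContinuousOn (cuspFunction 1 f) (Metric.closedBall 0 (Real.exp (-π))) := by
    intro q hq
    refine (ModularFormClass.differentiableAt_cuspFunction f one_pos one_mem_strictPeriods_SL
      ?_).continuousAt.continuousWithinAt
    exact lt_of_le_of_lt (mem_closedBall_zero_iff.mp hq)
      (Real.exp_lt_one_iff.mpr (by linarith [Real.pi_pos]))
  obtain ⟨K, hK⟩ := (isCompact_closedBall (0 : ℂ) _).exists_bound_of_continuousOn hcont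
  refine ⟨K, fun τ hτ => ?_⟩
  rw [← SlashInvariantFormClass.eq_cuspFunction f τ one_mem_strictPeriods_SL one_ne_zero]
  apply hK
  rw [mem_closedBall_zero_iff]
  exact Function.Periodic.norm_qParam_le_of_one_half_le_im (by simpa using hτ)

/-- `|q_τ| = e^{−2π Im τ}`. [folklore] -/
private theorem norm_qParam_one (τ : ℍ) : ‖Function.Periodic.qParam 1 τ‖ = Real.exp (-2 * π * τ.im) := by
  rw [Function.Periodic.norm_qParam]
  simp

/-- `|E₄(τ)| ≥ 1/2` for `Im τ ≥ Y`: the `q`-expansion of `E₄` is continuous at `q = 0` with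
value `1` (Mathlib `EisensteinSeries.E_qExpansion_coeff_zero`). This is the easy half of
Silverman's (5) ("alright as `τ → i∞`"). [folklore] -/
private theorem exists_one_half_le_norm_E₄ :
    ∃ Y : ℝ, ∀ τ : ℍ, Y ≤ τ.im → 1 / 2 ≤ ‖E₄ τ‖ := by
  have ha : AnalyticAt ℂ (cuspFunction 1 E₄) 0 :=
    ModularFormClass.analyticAt_cuspFunction_zero E₄ one_pos one_mem_strictPeriods_SL
  have h0 : cuspFunction 1 E₄ 0 = 1 := by
    have := EisensteinSeries.E_qExpansion_coeff_zero (k := 4) (by norm_num) ⟨2, rfl⟩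
    rw [qExpansion_coeff] at this
    simpa using this
  have hc := ha.continuousAt
  rw [Metric.continuousAt_iff] at hc
  obtain ⟨δ, hδ, hδ'⟩ := hc (1 / 2) one_half_pos
  refine ⟨-Real.log δ / (2 * π) + 1, fun τ hτ => ?_⟩
  have hq : ‖Function.Periodic.qParam 1 τ‖ < δ := by
    rw [norm_qParam_one, ← Real.lt_log_iff_exp_lt hδ]
    have hπ : 0 < 2 * π := by positivity
    have : -Real.log δ / (2 * π) < τ.im := by linarith
    rw [div_lt_iff₀ hπ] at this
    linarith
  have h1 := hδ' (x := Function.Periodic.qParam 1 τ) (by simpa using hq)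
  rw [SlashInvariantFormClass.eq_cuspFunction E₄ τ one_mem_strictPeriods_SL one_ne_zero, h0,
    dist_eq_norm] at h1
  have := norm_sub_norm_le (1 : ℂ) (E₄ τ)
  rw [norm_one, norm_sub_rev] at this
  linarith

/-- **Silverman's (4), upper half**: `|Δ(τ)| ≤ K e^{−2π Im τ}` on `Im τ ≥ 1/2` (`Δ` is a cusp
form: exponential decay high in the cusp, Mathlib `CuspFormClass.exp_decay_atImInfty`, and
boundedness on the rest of `Im τ ≥ 1/2`). [folklore] -/
private theorem exists_norm_discriminant_le :
    ∃ K : ℝ, ∀ τ : ℍ, 1 / 2 ≤ τ.im →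
      ‖ModularForm.discriminant τ‖ ≤ K * Real.exp (-2 * π * τ.im) := by
  obtain ⟨c, hc⟩ := (CuspFormClass.exp_decay_atImInfty (CuspForm.discriminant) one_pos
    one_mem_strictPeriods_SL).bound
  obtain ⟨A, hA⟩ := (atImInfty_mem _).mp hc
  obtain ⟨K₀, hK₀⟩ := exists_norm_le_of_one_half_le_im (CuspForm.discriminant)
  refine ⟨max c 0 + max K₀ 0 * Real.exp (2 * π * A), fun τ hτ => ?_⟩
  have hexp : 0 < Real.exp (-2 * π * τ.im) := Real.exp_pos _
  rcases le_or_gt A τ.im with hle | hlt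
  · have h1 := hA τ hle
    simp only [Set.mem_setOf_eq, CuspForm.coe_discriminant, div_one, Real.norm_eq_abs,
      abs_of_pos hexp] at h1
    calc ‖ModularForm.discriminant τ‖ ≤ c * Real.exp (-2 * π * τ.im) := h1
      _ ≤ (max c 0 + max K₀ 0 * Real.exp (2 * π * A)) * Real.exp (-2 * π * τ.im) := by
        gcongr
        calc c ≤ max c 0 := le_max_left _ _
          _ ≤ max c 0 + max K₀ 0 * Real.exp (2 * π * A) :=
              le_add_of_nonneg_right (by positivity)
  · have h1 := hK₀ τ hτ
    simp only [CuspForm.coe_discriminant] at h1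
    have h2 : 1 ≤ Real.exp (2 * π * A) * Real.exp (-2 * π * τ.im) := by
      rw [← Real.exp_add]
      apply Real.one_le_exp
      nlinarith [Real.pi_pos]
    calc ‖ModularForm.discriminant τ‖ ≤ max K₀ 0 := h1.trans (le_max_left _ _)
      _ ≤ max K₀ 0 * (Real.exp (2 * π * A) * Real.exp (-2 * π * τ.im)) :=
          le_mul_of_one_le_right (le_max_right _ _) h2
      _ ≤ (max c 0 + max K₀ 0 * Real.exp (2 * π * A)) * Real.exp (-2 * π * τ.im) := by
          nlinarith [le_max_right c 0, le_max_right K₀ 0, Real.exp_pos (2 * π * A)]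

/-- **Silverman's (4), lower half, on a horizontal strip**: `|Δ(τ)| ≥ m > 0` for
`1/2 ≤ Im τ ≤ Y` — the `q`-expansion of `Δ` is continuous and nonvanishing (`Δ = η²⁴ ≠ 0`,
Mathlib `ModularForm.discriminant_ne_zero`) on the compact annulus
`e^{−2πY} ≤ |q| ≤ e^{−π}`. [folklore] -/
private theorem exists_le_norm_discriminant (Y : ℝ) :
    ∃ m : ℝ, 0 < m ∧ ∀ τ : ℍ, 1 / 2 ≤ τ.im → τ.im ≤ Y → m ≤ ‖ModularForm.discriminant τ‖ := by
  set F := cuspFunction 1 (⇑CuspForm.discriminant) with hF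
  set S : Set ℂ := Metric.closedBall 0 (Real.exp (-π)) ∩ {q | Real.exp (-2 * π * Y) ≤ ‖q‖}
  have hScpt : IsCompact S :=
    (isCompact_closedBall (0 : ℂ) _).inter_right (isClosed_le continuous_const continuous_norm)
  have hS1 : ∀ q ∈ S, ‖q‖ < 1 := fun q hq =>
    lt_of_le_of_lt (mem_closedBall_zero_iff.mp hq.1)
      (Real.exp_lt_one_iff.mpr (by linarith [Real.pi_pos]))
  have hS0 : ∀ q ∈ S, q ≠ 0 := fun q hq => by
    have : 0 < ‖q‖ := lt_of_lt_of_le (Real.exp_pos _) hq.2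
    exact norm_pos_iff.mp this
  have hFne : ∀ q ∈ S, F q ≠ 0 := by
    intro q hq
    have him := Function.Periodic.im_invQParam_pos_of_norm_lt_one one_pos (hS1 q hq) (hS0 q hq)
    have := SlashInvariantFormClass.eq_cuspFunction (CuspForm.discriminant)
      ⟨_, him⟩ one_mem_strictPeriods_SL one_ne_zero
    rw [UpperHalfPlane.coe_mk,
      Function.Periodic.qParam_right_inv one_ne_zero (hS0 q hq)] at this
    rw [hF, this]
    exact ModularForm.discriminant_ne_zero _
  have hcont : ContinuousOn (fun q => (F q)⁻¹) S := by
    refine ContinuousOn.inv₀ (fun q hq => ?_) hFne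
    exact (ModularFormClass.differentiableAt_cuspFunction (CuspForm.discriminant) one_pos
      one_mem_strictPeriods_SL (hS1 q hq)).continuousAt.continuousWithinAt
  obtain ⟨B, hB⟩ := hScpt.exists_bound_of_continuousOn hcont
  refine ⟨1 / max B 1, by positivity, fun τ h1 h2 => ?_⟩
  have hqS : Function.Periodic.qParam 1 τ ∈ S := by
    refine ⟨mem_closedBall_zero_iff.mpr
      (Function.Periodic.norm_qParam_le_of_one_half_le_im (by simpa using h1)), ?_⟩
    simp only [Set.mem_setOf_eq, norm_qParam_one]
    apply Real.exp_le_exp.mpr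
    nlinarith [Real.pi_pos]
  have h3 := hB _ hqS
  have h4 := hFne _ hqS
  rw [hF, SlashInvariantFormClass.eq_cuspFunction (CuspForm.discriminant) τ
    one_mem_strictPeriods_SL one_ne_zero] at h3 h4
  simp only [CuspForm.coe_discriminant, norm_inv] at h3 h4
  rw [div_le_iff₀ (by positivity)]
  have h5 : 0 < ‖ModularForm.discriminant τ‖ := norm_pos_iff.mpr h4
  calc 1 = ‖ModularForm.discriminant τ‖⁻¹ * ‖ModularForm.discriminant τ‖ := by field_simp
    _ ≤ max B 1 * ‖ModularForm.discriminant τ‖ := by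
        gcongr
        exact h3.trans (le_max_left _ _)
    _ = ‖ModularForm.discriminant τ‖ * max B 1 := mul_comm _ _

/-! ### Step 4: the discharge -/

/-- **Silverman 1986, proof of Cor. 2.3 — discharge of `silverman1986_log_max_sub_height`.**
With `M = max(|Δ_W|, |c₄|³)` and `h = −½ log covol(Λ)`: in normal form
(`exists_normalForm`, the dictionary) `M · covol⁶ = 2¹²π¹² (Im τ)⁶ max(|Δ(τ)|, |E₄(τ)|³)` with
`Im τ ≥ 1/2` and `M ≥ |E₄(τ)|³/|Δ(τ)|` (as `|Δ_W| ≥ 1`). Lower bound: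
`max(|Δ|, |E₄|³) ≥ min(1/8, m)` (Step 3). Upper bound: `max(|Δ|, |E₄|³)` is bounded and either
`Im τ ≤ Y` or `M ≥ e^{2π Im τ}/(8K)`, so `Im τ ≤ A(1 + log M)` (Silverman's (5)–(7)), whence
`log(M covol⁶) ≤ 6 log(1 + log M) + C₁`.
[cite: Silverman1986, Cor. 2.3 (proof, p. 334) with Prop. 1.1, §2 (4)–(7) and (14)] -/
theorem silverman1986_log_max_sub_height_holds : silverman1986_log_max_sub_height := by
  obtain ⟨K₄, hK₄⟩ := exists_norm_le_of_one_half_le_im E₄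
  obtain ⟨KΔ, hKΔ⟩ := exists_norm_le_of_one_half_le_im CuspForm.discriminant
  obtain ⟨Y, hY⟩ := exists_one_half_le_norm_E₄
  obtain ⟨K, hK⟩ := exists_norm_discriminant_le
  obtain ⟨m, hm, hm'⟩ := exists_le_norm_discriminant (max Y 1)
  -- the absolute constants
  set Φ₀ : ℝ := min (1 / 8) m with hΦ₀
  set Φ₁ : ℝ := max (max KΔ 1) (max K₄ 1 ^ 3) with hΦ₁
  set A : ℝ := max Y 1 + |Real.log (8 * max K 1)| / (2 * π) with hA
  have hΦ₀pos : 0 < Φ₀ := lt_min (by norm_num) hm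
  have hA1 : 1 ≤ A := le_trans (le_max_right Y 1) (le_add_of_nonneg_right (by positivity))
  have hApos : 0 < A := lt_of_lt_of_le one_pos hA1
  refine ⟨Real.log (4096 * π ^ 12) + 6 * Real.log (1 / 2) + Real.log Φ₀,
    Real.log (4096 * π ^ 12) + 6 * Real.log A + Real.log Φ₁, ?_⟩
  intro W _ _ L hL
  obtain ⟨ω, τ, hω, hτ, hG4, hG6, hcov⟩ := exists_normalForm L
  -- abbreviations
  set y : ℝ := τ.im with hy_def
  set e4 : ℝ := ‖E₄ τ‖ with he4
  set d : ℝ := ‖ModularForm.discriminant τ‖ with hd_def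
  set Φ : ℝ := max d (e4 ^ 3) with hΦ
  have hy : 1 / 2 ≤ y := hτ
  have hypos : 0 < y := by linarith
  have hd : 0 < d := norm_pos_iff.mpr (ModularForm.discriminant_ne_zero τ)
  have he4nn : 0 ≤ e4 := norm_nonneg _
  have hΦpos : 0 < Φ := lt_max_of_lt_left hd
  have hωpos : 0 < ‖ω‖ := norm_pos_iff.mpr hω
  -- the dictionary, in `ℝ`: `|c₄| = P e4`, `|Δ_W| = P³ d`, `M = P³ Φ`, `P = 16π⁴/|ω|⁴`
  set P : ℝ := 16 * π ^ 4 / ‖ω‖ ^ 4 with hP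
  have hPpos : 0 < P := by positivity
  have hc4 : |((W.c₄ : ℚ) : ℝ)| = P * e4 := by
    rw [abs_ratCast_eq_norm, c₄_eq_of_normalForm W L hL hG4]
    simp [norm_inv, norm_pow, hP, he4, div_eq_mul_inv, abs_of_pos Real.pi_pos]
  have hP3 : P ^ 3 = 4096 * π ^ 12 / ‖ω‖ ^ 12 := by rw [hP]; ring
  have hΔ : |((W.Δ : ℚ) : ℝ)| = P ^ 3 * d := by
    rw [abs_ratCast_eq_norm, Δ_eq_of_normalForm W L hL hG4 hG6, hP3]
    simp [norm_inv, norm_pow, hd_def, div_eq_mul_inv, abs_of_pos Real.pi_pos]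
  have hM : ((max |W.Δ| (|W.c₄| ^ 3) : ℚ) : ℝ) = P ^ 3 * Φ := by
    rw [Rat.cast_max, Rat.cast_pow, Rat.cast_abs, Rat.cast_abs, hc4, hΔ, mul_pow, hΦ,
      mul_max_of_nonneg _ _ (by positivity)]
  have hM1 : 1 ≤ P ^ 3 * Φ := hM ▸ one_le_max_abs_Δ_c4 W
  have hΔ1 : 1 ≤ P ^ 3 * d := hΔ ▸ one_le_abs_Δ W
  have hlogM : 0 ≤ Real.log (P ^ 3 * Φ) := Real.log_nonneg hM1
  -- `X = log M − 12 h = log(4096 π¹²) + 6 log y + log Φ` (Silverman's Prop. 1.1 for `K = ℚ`)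
  have hX : Real.log (P ^ 3 * Φ) - 12 * neronLatticeHeight L =
      Real.log (4096 * π ^ 12) + 6 * Real.log y + Real.log Φ := by
    have key : P ^ 3 * Φ * (‖ω‖ ^ 2 * y) ^ 6 = 4096 * π ^ 12 * y ^ 6 * Φ := by
      rw [hP3]
      field_simp
    have h1 : Real.log (P ^ 3 * Φ * (‖ω‖ ^ 2 * y) ^ 6) =
        Real.log (P ^ 3 * Φ) + 6 * Real.log (‖ω‖ ^ 2 * y) := by
      rw [Real.log_mul (by positivity) (by positivity), Real.log_pow]
      push_cast
      ring
    rw [twelve_mul_neronLatticeHeight, hcov,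
      show Real.log (P ^ 3 * Φ) - -6 * Real.log (‖ω‖ ^ 2 * y) =
        Real.log (P ^ 3 * Φ) + 6 * Real.log (‖ω‖ ^ 2 * y) by ring, ← h1, key,
      Real.log_mul (by positivity) hΦpos.ne', Real.log_mul (by positivity) (by positivity),
      Real.log_pow]
    push_cast
    ring
  rw [hM, hX]
  constructor
  · -- lower bound: `Φ ≥ Φ₀` and `y ≥ 1/2`
    have hΦ₀Φ : Φ₀ ≤ Φ := by
      rcases le_or_gt (max Y 1) y with h | h
      · have h1 : 1 / 2 ≤ e4 := hY τ ((le_max_left _ _).trans h)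
        calc Φ₀ ≤ 1 / 8 := min_le_left _ _
          _ = (1 / 2) ^ 3 := by norm_num
          _ ≤ e4 ^ 3 := pow_le_pow_left₀ (by norm_num) h1 3
          _ ≤ Φ := le_max_right _ _
      · calc Φ₀ ≤ m := min_le_right _ _
          _ ≤ d := hm' τ hy h.le
          _ ≤ Φ := le_max_left _ _
    have h1 : Real.log Φ₀ ≤ Real.log Φ := Real.log_le_log hΦ₀pos hΦ₀Φ
    have h2 : Real.log (1 / 2) ≤ Real.log y := Real.log_le_log (by norm_num) hy
    linarith
  · -- upper bound: `Φ ≤ Φ₁` and `y ≤ A (1 + log M)`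
    have hΦΦ₁ : Φ ≤ Φ₁ := by
      refine max_le ((hKΔ τ hy).trans ?_) (le_trans ?_ (le_max_right _ _))
      · exact le_trans (le_max_left _ _) (le_max_left _ _)
      · exact pow_le_pow_left₀ he4nn ((hK₄ τ hy).trans (le_max_left _ _)) 3
    have hyA : y ≤ A * (1 + Real.log (P ^ 3 * Φ)) := by
      rcases le_or_gt (max Y 1) y with h | h
      · -- high in the cusp: `|j(τ)| ≤ M` forces `e^{2πy} ≤ 8 K M` (Silverman's (5))
        have h1 : 1 / 2 ≤ e4 := hY τ ((le_max_left _ _).trans h)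
        have h2 : d ≤ K * Real.exp (-2 * π * y) := hK τ hy
        have hexp : 0 < Real.exp (-2 * π * y) := Real.exp_pos _
        have hKpos : 0 < K := by
          by_contra hK0
          push Not at hK0
          nlinarith
        have h18 : 1 / 8 ≤ e4 ^ 3 :=
          calc (1 / 8 : ℝ) = (1 / 2) ^ 3 := by norm_num
            _ ≤ e4 ^ 3 := pow_le_pow_left₀ (by norm_num) h1 3
        have h6 : Real.exp (2 * π * y) * d ≤ K := by
          have hprod : Real.exp (2 * π * y) * Real.exp (-2 * π * y) = 1 := by
            rw [← Real.exp_add, ← Real.exp_zero]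
            congr 1; ring
          calc Real.exp (2 * π * y) * d
              ≤ Real.exp (2 * π * y) * (K * Real.exp (-2 * π * y)) := by gcongr
            _ = K * (Real.exp (2 * π * y) * Real.exp (-2 * π * y)) := by ring
            _ = K := by rw [hprod, mul_one]
        have h5 : Real.exp (2 * π * y) ≤ 8 * K * (P ^ 3 * Φ) :=
          calc Real.exp (2 * π * y) = Real.exp (2 * π * y) * 1 := (mul_one _).symm
            _ ≤ Real.exp (2 * π * y) * (P ^ 3 * d) := by gcongr
            _ = (Real.exp (2 * π * y) * d) * P ^ 3 := by ring
            _ ≤ K * P ^ 3 := by gcongr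
            _ = 8 * K * (P ^ 3 * (1 / 8)) := by ring
            _ ≤ 8 * K * (P ^ 3 * Φ) := by gcongr; exact h18.trans (le_max_right _ _)
        have h7 : 2 * π * y ≤ Real.log (8 * K) + Real.log (P ^ 3 * Φ) := by
          rw [← Real.log_mul (by positivity) (by positivity), ← Real.log_exp (2 * π * y)]
          exact Real.log_le_log (Real.exp_pos _) h5
        have h8 : Real.log (8 * K) ≤ |Real.log (8 * max K 1)| :=
          le_trans (Real.log_le_log (by positivity) (by gcongr; exact le_max_left _ _))
            (le_abs_self _)
        have hπ : 0 < 2 * π := by positivity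
        have hπ1 : 1 ≤ 2 * π := by linarith [Real.two_le_pi]
        set C : ℝ := |Real.log (8 * max K 1)| / (2 * π) with hC
        have h9 : y ≤ C + Real.log (P ^ 3 * Φ) / (2 * π) := by
          rw [hC, ← add_div, le_div_iff₀ hπ]; linarith
        have h10 : Real.log (P ^ 3 * Φ) / (2 * π) ≤ A * Real.log (P ^ 3 * Φ) :=
          (div_le_self hlogM hπ1).trans (le_mul_of_one_le_left hlogM hA1)
        have h11 : 0 ≤ max Y 1 := le_trans zero_le_one (le_max_right _ _)
        have h12 : A * (1 + Real.log (P ^ 3 * Φ)) =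
            max Y 1 + C + A * Real.log (P ^ 3 * Φ) := by
          rw [hA, hC]; ring
        linarith
      · calc y ≤ max Y 1 := h.le
          _ ≤ A := le_add_of_nonneg_right (by positivity)
          _ ≤ A * (1 + Real.log (P ^ 3 * Φ)) :=
              le_mul_of_one_le_right hApos.le (by linarith)
    have h1 : Real.log Φ ≤ Real.log Φ₁ := Real.log_le_log hΦpos hΦΦ₁
    have h2 : Real.log y ≤ Real.log A + Real.log (1 + Real.log (P ^ 3 * Φ)) := by
      rw [← Real.log_mul hApos.ne' (by linarith)]
      exact Real.log_le_log hypos hyA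
    linarith

end Literature.NumberTheory.EllipticCurves.ModularForms

end
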